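import Mathlib
import HarnessLib
import Summits.NavierStokesRegularity.NavierStokesRegularity.Theorems.HalfSpaceWindowDoorCirculationCarryingRigidityFarConeLiouville
import Summits.NavierStokesRegularity.NavierStokesRegularity.Theorems.HalfSpaceWindowDoorCirculationCarryingRigidityRadConeSweeping
import Summits.NavierStokesRegularity.NavierStokesRegularity.Theorems.HalfSpaceWindowDoorCirculationCarryingRigidityRadConeRigidity
import Summits.NavierStokesRegularity.NavierStokesRegularity.Theorems.AxisTwistDoorAveragedConeLiouvilleCircleLimits

/-!
# Route `HalfSpaceWindowDoor`, crux `CirculationCarryingRigidity` (stmt-NavierStokesRegularity-25311) —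
# line `cone_sweep`, RADIAL form, Step 4: a RADIAL circle cone on FAR circles about ONE axis already forces poloidality

LEAD ns-hsw-p1 g9, `--supports stmt-NavierStokesRegularity-25311 --as helper`; card `Cruxes/…/Lines/cone_sweep.md`.  Generalisation of
`…FarConeLiouville.inner_curl_e3_eq_zero_of_farConed` (p684672) to the weakest hypothesis the sweeping argument uses.

**Theorem (`inner_curl_e3_eq_zero_of_radConed`).**  A door-class profile (`‖v(s)‖_∞ ≤ C/√(−s)`, continuity, Oseen–Duhamel,
divergence-free) with `⟪curl v, e₃⟫ ≥ 0` satisfying the RADIAL circle cone `∮_{S(r,z)}|ω_r| dl ≤ K∮_{S(r,z)}ω₃ dl` on every circle about the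
`e₃`-axis of radius `r ≥ R₀√(−s)` (any `C`, `K ≥ 0`, `R₀ ≥ 0`) is POLOIDAL: `⟪curl v, e₃⟫ ≡ 0` — exactly the conclusion of the open stub
`HemisphereLiouvilleE3`.  The AZIMUTHAL vorticity `ω_θ` and everything inside the parabolic tube are free.  Proof as in p684672 with the radial files
`…RadConeFlux` (p685261) / `…RadConeSweeping` / `…RadConeRigidity`: the hypothesis is invariant under the Navier–Stokes zooms about axis points
(`radAbs_zoom_axis`) and closed under F3 limits (`tendsto_radAbs`); `S₀ = sup Γ` finite; `S₀ = 0` ⇒ every slice is saturated by a far disc ⇒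
`ω₃ ≡ 0` slice by slice; `S₀ > 0` ⇒ extracted limit with a saturated disc of radius `R₁ ≥ R₀ + 1` on the slice `−1` ⇒ that slice carries no
circulation (`circ_eq_zero_of_saturated_rad`) ⇒ contradiction.  Crux format: `not_isBackwardSingularPoint_of_radConed`; census reading
`enemy_radCone_fails`: a circulation-carrying closed-hemisphere profile violates EVERY radial far-circle cone about the axis at some time.
WHAT THIS IS NOT: not about NS regularity; HYPOTHETICAL profiles; `HemisphereLiouvilleE3` (no cone at all) stays OPEN.  No item is closed.
-/

noncomputable section

-- the summit and its single sub-problem share the name (CONVENTIONS §1), as in every Theorems file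
set_option linter.dupNamespace false

namespace Summit.NavierStokesRegularity.NavierStokesRegularity.Theorems.HalfSpaceWindowDoorCirculationCarryingRigidityRadConeLiouville

open MeasureTheory Set Function Filter Topology InnerProductSpace
open scoped RealInnerProductSpace InnerProductSpace
open Literature.Analysis Literature.Analysis.UnboundedOperators
open Literature.Analysis.FluidPDE hiding eR
open Summit.NavierStokesRegularity.NavierStokesRegularity.Theses.HalfSpaceWindowDoor
open Summit.NavierStokesRegularity.NavierStokesRegularity.Theorems.HalfSpaceWindowDoorCirculationCarryingRigidityDefs
  (InDoorClass SignE3 e3)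
open Summit.NavierStokesRegularity.NavierStokesRegularity.Theorems.AxisTwistDoorAveragedConeLiouvilleDefs (cylPt eT eR circ vortCirc)
open Summit.NavierStokesRegularity.NavierStokesRegularity.Theorems.AveragedConeLiouville.CircleStokes (inner_e3 continuous_eR)
open Summit.NavierStokesRegularity.NavierStokesRegularity.Theorems.AxisTwistDoorAveragedConeLiouvilleCylFrame (norm_eR abs_inner_eR_le)
open Summit.NavierStokesRegularity.NavierStokesRegularity.Theorems.AveragedConeLiouville.CircMonotone (circ_zero circ_nonneg)
open Summit.NavierStokesRegularity.NavierStokesRegularity.Theorems.AveragedConeLiouville.CircleLimits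
  (tendsto_circ tendsto_vortCirc tendsto_circleIntegral tendstoLocallyUniformly_curl)
open Summit.NavierStokesRegularity.NavierStokesRegularity.Theorems
  (exists_tendsto_of_isTypeIAncientMild_seq isTypeIAncientMild_zoom zoom_apply)
open Summit.NavierStokesRegularity.NavierStokesRegularity.Theorems.HalfSpaceWindowDoorCirculationCarryingRigidityGaussExtremal
  (inDoorClass_of_isTypeIAncientMild)
open Summit.NavierStokesRegularity.NavierStokesRegularity.Theorems.HalfSpaceWindowDoorCirculationCarryingRigidityHorizontalVorticityFloor
  (tendsto_curl_of_tendsto_fderiv)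
open Summit.NavierStokesRegularity.NavierStokesRegularity.Theorems.PoloidalWindowDoorPoloidalWindowRigidityWindow
  (isTypeIAncientMild_of_class)
open Summit.NavierStokesRegularity.NavierStokesRegularity.Theorems.HalfSpaceWindowDoorCirculationCarryingRigidityConeFluxSubsolution
  (signE3_atd contDiff_one_slice tube_bddAbove)
open Summit.NavierStokesRegularity.NavierStokesRegularity.Theorems.HalfSpaceWindowDoorCirculationCarryingRigidityRadConeSweeping
  (circ_le_sSup_of_radCone circ_le_const_of_radCone)
open Summit.NavierStokesRegularity.NavierStokesRegularity.Theorems.HalfSpaceWindowDoorCirculationCarryingRigidityRadConeRigidity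
  (inner_curl_e3_eq_zero_of_saturated_rad circ_eq_zero_of_saturated_rad)
open Summit.NavierStokesRegularity.NavierStokesRegularity.Theorems.HalfSpaceWindowDoorCirculationCarryingRigidityConeLiouville
  (axisPt_add_smul_cylPt circ_zoom_axis)
open Summit.NavierStokesRegularity.NavierStokesRegularity.Theorems.HalfSpaceWindowDoorCirculationCarryingRigidityFarConeLiouville
  (vortCirc_zoom_axis)

variable {C : ℝ} {v : ℝ → EuclideanSpace ℝ (Fin 3) → EuclideanSpace ℝ (Fin 3)}

/-! ### The radial circle cone under zooms about axis points and under limits -/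

/-- `∮|ω_r| dl` under the zoom about `(0,0,ζ)`: `radAbs[c • v(c²·,(0,0,ζ)+c·)](r,z,s) = c·radAbs[v](c r, ζ + c z, c² s)`. -/
theorem radAbs_zoom_axis (c ζ : ℝ) (u : ℝ → EuclideanSpace ℝ (Fin 3) → EuclideanSpace ℝ (Fin 3)) (r z s : ℝ) :
    (∫ θ in (0 : ℝ)..(2 * Real.pi), |⟪curl ((c • stPull (c ^ 2) c 0 (cylPt 0 0 ζ) u) s) (cylPt r θ z), eR θ⟫| * r) =
      c * ∫ θ in (0 : ℝ)..(2 * Real.pi), |⟪curl (u (c ^ 2 * s)) (cylPt (c * r) θ (ζ + c * z)), eR θ⟫| * (c * r) := by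
  rw [← intervalIntegral.integral_const_mul]
  refine intervalIntegral.integral_congr fun θ _ => ?_
  simp only [curl_smul_stPull, zero_add, axisPt_add_smul_cylPt, inner_smul_left, RCLike.conj_to_real]
  rw [abs_mul, abs_of_nonneg (mul_self_nonneg c)]
  ring

/-- The radial far-field circle cone is invariant under the zooms about axis points (`c > 0`). -/
theorem radCone_zoom {K R₀ : ℝ} {u : ℝ → EuclideanSpace ℝ (Fin 3) → EuclideanSpace ℝ (Fin 3)}
    (hu : ∀ s < 0, ∀ r : ℝ, R₀ * Real.sqrt (-s) ≤ r → ∀ z : ℝ,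
      (∫ θ in (0 : ℝ)..(2 * Real.pi), |⟪curl (u s) (cylPt r θ z), eR θ⟫| * r) ≤ K * vortCirc u r z s)
    {c : ℝ} (hc : 0 < c) (ζ : ℝ) :
    ∀ s < 0, ∀ r : ℝ, R₀ * Real.sqrt (-s) ≤ r → ∀ z : ℝ,
      (∫ θ in (0 : ℝ)..(2 * Real.pi), |⟪curl ((c • stPull (c ^ 2) c 0 (cylPt 0 0 ζ) u) s) (cylPt r θ z), eR θ⟫| * r) ≤
        K * vortCirc (c • stPull (c ^ 2) c 0 (cylPt 0 0 ζ) u) r z s := by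
  intro s hs r hr z
  rw [radAbs_zoom_axis, vortCirc_zoom_axis]
  have hs' : c ^ 2 * s < 0 := mul_neg_of_pos_of_neg (pow_pos hc 2) hs
  have hr' : R₀ * Real.sqrt (-(c ^ 2 * s)) ≤ c * r := by
    rw [show -(c ^ 2 * s) = c ^ 2 * (-s) by ring, Real.sqrt_mul' _ (neg_pos.2 hs).le, Real.sqrt_sq hc.le]
    nlinarith [hr, hc]
  have h := hu _ hs' _ hr' (ζ + c * z)
  nlinarith [h, hc]

/-- `∮|ω_r| dl` passes to the limit under locally uniform convergence of the vorticity slices. -/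
theorem tendsto_radAbs {w : ℕ → ℝ → EuclideanSpace ℝ (Fin 3) → EuclideanSpace ℝ (Fin 3)}
    {W : ℝ → EuclideanSpace ℝ (Fin 3) → EuclideanSpace ℝ (Fin 3)} {t : ℝ}
    (hw : ∀ j, Continuous (curl (w j t))) (hW : Continuous (curl (W t)))
    (h : TendstoLocallyUniformly (fun j => curl (w j t)) (curl (W t)) atTop) (r z : ℝ) :
    Tendsto (fun j => ∫ θ in (0 : ℝ)..(2 * Real.pi), |⟪curl (w j t) (cylPt r θ z), eR θ⟫| * r) atTop
      (𝓝 (∫ θ in (0 : ℝ)..(2 * Real.pi), |⟪curl (W t) (cylPt r θ z), eR θ⟫| * r)) := by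
  refine tendsto_circleIntegral (F := fun j => curl (w j t)) hw hW h (Φ := fun θ a => |⟪a, eR θ⟫| * r) ?_
    (abs_nonneg r) (fun θ a b => ?_) r z
  · exact ((continuous_snd.inner (continuous_eR.comp continuous_fst)).abs).mul continuous_const
  · show |(|⟪a, eR θ⟫| * r) - |⟪b, eR θ⟫| * r| ≤ |r| * ‖a - b‖
    rw [← sub_mul, abs_mul]
    have h1 : abs (|⟪a, eR θ⟫| - |⟪b, eR θ⟫|) ≤ ‖a - b‖ := by
      refine (abs_abs_sub_abs_le_abs_sub _ _).trans ?_
      rw [← inner_sub_left]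
      exact abs_inner_eR_le (a - b) θ
    calc abs (|⟪a, eR θ⟫| - |⟪b, eR θ⟫|) * |r| ≤ ‖a - b‖ * |r| := mul_le_mul_of_nonneg_right h1 (abs_nonneg r)
      _ = |r| * ‖a - b‖ := mul_comm _ _

/-! ### The theorem -/

/-- **THE RADIAL CONE STRATUM IS POLOIDAL (all `C`, `K`, `R₀`).**  A closed-hemisphere door-class profile with the RADIAL circle cone
`∮|ω_r| dl ≤ K∮ω₃ dl` on every circle about the `e₃`-axis of radius `≥ R₀√(−s)` has `⟪curl v, e₃⟫ ≡ 0`. -/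
theorem inner_curl_e3_eq_zero_of_radConed (hv : InDoorClass C v) (hsign : SignE3 v) {K : ℝ} (hK : 0 ≤ K)
    {R₀ : ℝ} (hR₀ : 0 ≤ R₀) (hcone : ∀ s < 0, ∀ r : ℝ, R₀ * Real.sqrt (-s) ≤ r → ∀ z : ℝ,
      (∫ θ in (0 : ℝ)..(2 * Real.pi), |⟪curl (v s) (cylPt r θ z), eR θ⟫| * r) ≤ K * vortCirc v r z s) :
    ∀ s < 0, ∀ y, ⟪curl (v s) y, e3⟫ = 0 := by
  have hA : IsTypeIAncientMild C v := isTypeIAncientMild_of_class hv.1 hv.2.1 hv.2.2.1 hv.2.2.2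
  set R₁ : ℝ := 4 * (C * (1 + K)) + R₀ + 1 with hR₁
  have hC : 0 ≤ C := hA.nonneg
  have hR₁0 : 0 ≤ R₁ := by positivity
  -- the total set of circulations and its supremum `S₀`
  set Tot : Set ℝ := {m | ∃ s : ℝ, s < 0 ∧ ∃ r : ℝ, 0 ≤ r ∧ ∃ z : ℝ, m = circ v r z s} with hTot
  have hTotle : ∀ m ∈ Tot, m ≤ 2 * Real.pi * (R₁ * C) := by
    rintro m ⟨s, hs, r, hr, z, rfl⟩
    exact circ_le_const_of_radCone hv hsign hK hR₀ hcone hs hr z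
  have hTotbdd : BddAbove Tot := ⟨_, hTotle⟩
  have hmem : ∀ s < 0, ∀ r : ℝ, 0 ≤ r → ∀ z, circ v r z s ∈ Tot := fun s hs r hr z => ⟨s, hs, r, hr, z, rfl⟩
  have hTotne : Tot.Nonempty := ⟨_, hmem (-1) (by norm_num) 0 le_rfl 0⟩
  set S₀ : ℝ := sSup Tot with hS₀
  have hleS : ∀ s < 0, ∀ r : ℝ, 0 ≤ r → ∀ z, circ v r z s ≤ S₀ := fun s hs r hr z => le_csSup hTotbdd (hmem s hs r hr z)
  have hm1 : (-1 : ℝ) < 0 := by norm_num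
  rcases le_or_gt S₀ 0 with hS | hS
  · -- every slice `s` is saturated (with `S = 0`) by the far disc of radius `R₀√(−s) + 1`
    intro s hs
    have hρ₀ : 0 ≤ R₀ * Real.sqrt (-s) := by positivity
    have h0 : circ v (R₀ * Real.sqrt (-s) + 1) 0 s = 0 :=
      le_antisymm ((hleS s hs _ (by positivity) 0).trans hS)
        (circ_nonneg v (contDiff_one_slice hv hs) (signE3_atd hsign) hs (by positivity) 0)
    exact inner_curl_e3_eq_zero_of_saturated_rad hv hsign hK hs hρ₀ (fun r hr z => hcone s hs r hr z)
      (R := R₀ * Real.sqrt (-s) + 1) (z₀ := 0) (S := 0) (by linarith) h0 fun r hr z => (hleS s hs r hr z).trans hS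
  -- `S₀ > 0`: near-maximal TUBE-BOUNDARY discs at some `(s_n, z_n)`
  exfalso
  have hnear : ∀ n : ℕ, ∃ p : ℝ × ℝ, p.1 < 0 ∧ S₀ - 1 / ((n : ℝ) + 1) < circ v (R₁ * Real.sqrt (-p.1)) p.2 p.1 := by
    intro n
    have hε : S₀ - 1 / ((n : ℝ) + 1) < S₀ := by
      have : (0 : ℝ) < 1 / ((n : ℝ) + 1) := by positivity
      linarith
    obtain ⟨m, ⟨s, hs, r, hr, z, rfl⟩, hm⟩ := exists_lt_of_lt_csSup hTotne hε
    -- the sweeping lemma at `s₁ = s`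
    have hsw := circ_le_sSup_of_radCone hv hsign hK hR₀ hcone hs le_rfl hr z
    obtain ⟨hTbdd, -⟩ := tube_bddAbove hv hR₁0 hs
    have hTne : {m' : ℝ | ∃ s' : ℝ, s' ≤ s ∧ ∃ z' : ℝ, m' = circ v (R₁ * Real.sqrt (-s')) z' s'}.Nonempty :=
      ⟨_, s, le_rfl, 0, rfl⟩
    obtain ⟨m', ⟨s', hs', z', rfl⟩, hm'⟩ := exists_lt_of_lt_csSup hTne (lt_of_lt_of_le hm hsw)
    exact ⟨(s', z'), lt_of_le_of_lt hs' hs, hm'⟩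
  choose p hp1 hp2 using hnear
  set sn : ℕ → ℝ := fun n => (p n).1 with hsn
  set zn : ℕ → ℝ := fun n => (p n).2 with hzn
  set lam : ℕ → ℝ := fun n => Real.sqrt (-sn n) with hlam
  have hlam0 : ∀ n, 0 < lam n := fun n => Real.sqrt_pos.2 (neg_pos.2 (hp1 n))
  have hlam2 : ∀ n, lam n ^ 2 = -sn n := fun n => Real.sq_sqrt (neg_pos.2 (hp1 n)).le
  -- the zooms about `(0,0,z_n)` with factor `λ_n = √(−s_n)`
  set w : ℕ → ℝ → EuclideanSpace ℝ (Fin 3) → EuclideanSpace ℝ (Fin 3) :=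
    fun n => lam n • stPull (lam n ^ 2) (lam n) 0 (cylPt 0 0 (zn n)) v with hw
  have hwcl : ∀ n, IsTypeIAncientMild C (w n) := fun n => isTypeIAncientMild_zoom hA (hlam0 n) _
  have hwcirc : ∀ n r z s, circ (w n) r z s = circ v (lam n * r) (zn n + lam n * z) (lam n ^ 2 * s) := fun n r z s =>
    circ_zoom_axis (lam n) (zn n) v r z s
  have hwR₁ : ∀ n, circ (w n) R₁ 0 (-1) = circ v (R₁ * Real.sqrt (-sn n)) (zn n) (sn n) := by
    intro n
    rw [hwcirc, mul_zero, add_zero, hlam2, mul_comm (lam n) R₁]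
    congr 1
    ring
  have hwle : ∀ n, ∀ σ < 0, ∀ r : ℝ, 0 ≤ r → ∀ z, circ (w n) r z σ ≤ S₀ := by
    intro n σ hσ r hr z
    rw [hwcirc]
    refine hleS _ ?_ _ (mul_nonneg (hlam0 n).le hr) _
    exact mul_neg_of_pos_of_neg (pow_pos (hlam0 n) 2) hσ
  have hwsign : ∀ n, SignE3 (w n) := by
    intro n σ hσ y
    have hcurl : curl (w n σ) y =
        (lam n * lam n) • curl (v (0 + lam n ^ 2 * σ)) (cylPt 0 0 (zn n) + lam n • y) :=
      curl_smul_stPull (lam n) (lam n ^ 2) (lam n) 0 (cylPt 0 0 (zn n)) v σ y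
    rw [hcurl, real_inner_smul_left]
    refine mul_nonneg (mul_self_nonneg _) (hsign _ ?_ _)
    rw [zero_add]; exact mul_neg_of_pos_of_neg (pow_pos (hlam0 n) 2) hσ
  have hwcone : ∀ n, ∀ s < 0, ∀ r : ℝ, R₀ * Real.sqrt (-s) ≤ r → ∀ z : ℝ,
      (∫ θ in (0 : ℝ)..(2 * Real.pi), |⟪curl (w n s) (cylPt r θ z), eR θ⟫| * r) ≤ K * vortCirc (w n) r z s :=
    fun n => radCone_zoom hcone (hlam0 n) _
  -- compactness
  obtain ⟨φ, hφ, W, hW, hpt, hptG, hlu, hluG⟩ := exists_tendsto_of_isTypeIAncientMild_seq C hwcl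
  have hWdoor : InDoorClass C W := inDoorClass_of_isTypeIAncientMild hW
  have hWsign : SignE3 W := by
    intro σ hσ y
    have hc : Tendsto (fun j => ⟪curl (w (φ j) σ) y, e3⟫) atTop (𝓝 ⟪curl (W σ) y, e3⟫) :=
      (tendsto_curl_of_tendsto_fderiv (hptG σ hσ y)).inner tendsto_const_nhds
    exact ge_of_tendsto' hc fun j => hwsign (φ j) σ hσ y
  have hcurlc : ∀ (u : ℝ → EuclideanSpace ℝ (Fin 3) → EuclideanSpace ℝ (Fin 3)), IsTypeIAncientMild C u → ∀ σ < 0,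
      Continuous (curl (u σ)) := by
    intro u hu σ hσ
    have h1 : ContDiff ℝ 1 (u σ) := (hu.contDiff_slice hσ).of_le (by norm_cast)
    have hD : Continuous (fderiv ℝ (u σ)) := h1.continuous_fderiv one_ne_zero
    have e : curl (u σ) = fun x => curlCLM (fderiv ℝ (u σ) x) := by funext x; exact curl_eq_curlCLM (u σ) x
    rw [e]; exact curlCLM.continuous.comp hD
  have hWcone1 : ∀ r : ℝ, R₀ ≤ r → ∀ z : ℝ,
      (∫ θ in (0 : ℝ)..(2 * Real.pi), |⟪curl (W (-1)) (cylPt r θ z), eR θ⟫| * r) ≤ K * vortCirc W r z (-1) := by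
    intro r hr z
    have hcu := tendstoLocallyUniformly_curl (hluG (-1) hm1)
    refine le_of_tendsto_of_tendsto'
      (tendsto_radAbs (fun j => hcurlc _ (hwcl (φ j)) (-1) hm1) (hcurlc _ hW (-1) hm1) hcu r z)
      ((tendsto_vortCirc (fun j => hcurlc _ (hwcl (φ j)) (-1) hm1) (hcurlc _ hW (-1) hm1) hcu r z).const_mul K) fun j => ?_
    exact hwcone (φ j) (-1) hm1 r (by rw [neg_neg, Real.sqrt_one, mul_one]; exact hr) z
  have hclim : ∀ σ < 0, ∀ r z, Tendsto (fun j => circ (w (φ j)) r z σ) atTop (𝓝 (circ W r z σ)) := fun σ hσ r z =>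
    tendsto_circ (fun j => (hwcl (φ j)).continuous_slice hσ) (hW.continuous_slice hσ) (hlu σ hσ) r z
  -- the saturated disc of the limit
  have hWR₁ : circ W R₁ 0 (-1) = S₀ := by
    refine tendsto_nhds_unique (hclim (-1) hm1 R₁ 0) ?_
    have hlow : Tendsto (fun j => S₀ - 1 / ((φ j : ℝ) + 1)) atTop (𝓝 S₀) := by
      have h1 : Tendsto (fun j => 1 / ((φ j : ℝ) + 1)) atTop (𝓝 0) := by
        have hφ' : Tendsto (fun j => ((φ j : ℕ) : ℝ)) atTop atTop :=
          tendsto_natCast_atTop_atTop.comp hφ.tendsto_atTop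
        have : Tendsto (fun j => ((φ j : ℝ) + 1)) atTop atTop := tendsto_atTop_add_const_right _ 1 hφ'
        exact tendsto_const_nhds.div_atTop this
      simpa using tendsto_const_nhds.sub h1
    refine tendsto_of_tendsto_of_tendsto_of_le_of_le hlow tendsto_const_nhds (fun j => ?_) fun j => ?_
    · rw [hwR₁]; exact (hp2 (φ j)).le
    · exact hwle (φ j) (-1) hm1 R₁ hR₁0 0
  have hWle : ∀ r : ℝ, 0 ≤ r → ∀ z, circ W r z (-1) ≤ S₀ := fun r hr z =>
    le_of_tendsto' (hclim (-1) hm1 r z) fun j => hwle (φ j) (-1) hm1 r hr z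
  have hR₀R₁ : R₀ ≤ R₁ := by rw [hR₁]; nlinarith [hC, hK]
  have h0 := circ_eq_zero_of_saturated_rad hWdoor hWsign hK hm1 hR₀ hWcone1 hR₀R₁ hWR₁ hWle R₁ 0
  linarith

/-- **CENSUS READING (enemy form).**  A circulation-carrying (`⟪curl v(σ)(y), e₃⟫ > 0` somewhere) closed-hemisphere door-class profile
VIOLATES EVERY RADIAL FAR-FIELD CIRCLE CONE about the axis: for all `K ≥ 0`, `R₀ ≥ 0` there are `s < 0`, `r ≥ R₀√(−s)` and `z` with
`∮_{S(r,z)}|ω_r| dl > K ∮_{S(r,z)} ω₃ dl` — the enemy's vortex lines cross far circles RADIALLY (in and out) with a radial flux not controlled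
by the vertical one (by translation / rotation covariance the same holds about every axis parallel to `e₃`). -/
theorem enemy_radCone_fails (hv : InDoorClass C v) (hsign : SignE3 v) (hpos : ∃ σ < 0, ∃ y, 0 < ⟪curl (v σ) y, e3⟫)
    {K : ℝ} (hK : 0 ≤ K) {R₀ : ℝ} (hR₀ : 0 ≤ R₀) :
    ∃ s < 0, ∃ r : ℝ, R₀ * Real.sqrt (-s) ≤ r ∧ ∃ z : ℝ,
      K * vortCirc v r z s < ∫ θ in (0 : ℝ)..(2 * Real.pi), |⟪curl (v s) (cylPt r θ z), eR θ⟫| * r := by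
  by_contra h
  push Not at h
  obtain ⟨σ, hσ, y, hy⟩ := hpos
  have h0 := inner_curl_e3_eq_zero_of_radConed hv hsign hK hR₀ (fun s hs r hr z => h s hs r hr z) σ hσ y
  exact hy.ne' h0

/-- **Crux format.**  In the situation of the crux `CirculationCarryingRigidity` specialised to `e = e₃` (closed hemisphere `⟪curl v, e₃⟫ ≥ 0`,
circulation-carrying), the radial far-field circle cone about the axis is contradictory — in particular the apex is not backward-singular. -/
theorem not_isBackwardSingularPoint_of_radConed (hv : InDoorClass C v) (hsign : SignE3 v)
    (hpos : ∃ σ < 0, ∃ y, 0 < ⟪curl (v σ) y, e3⟫) {K : ℝ} (hK : 0 ≤ K) {R₀ : ℝ} (hR₀ : 0 ≤ R₀)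
    (hcone : ∀ s < 0, ∀ r : ℝ, R₀ * Real.sqrt (-s) ≤ r → ∀ z : ℝ,
      (∫ θ in (0 : ℝ)..(2 * Real.pi), |⟪curl (v s) (cylPt r θ z), eR θ⟫| * r) ≤ K * vortCirc v r z s) :
    ¬ IsBackwardSingularPoint v 0 := by
  intro _
  obtain ⟨s, hs, r, hr, z, hlt⟩ := enemy_radCone_fails hv hsign hpos hK hR₀
  exact (not_lt.2 (hcone s hs r hr z)) hlt

end Summit.NavierStokesRegularity.NavierStokesRegularity.Theorems.HalfSpaceWindowDoorCirculationCarryingRigidityRadConeLiouville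

end
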